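import Literature.RepresentationTheory.TwistedCoinvariantsCompactIsotypic
import HarnessLib

/-!
# An isomorphism of twisted coinvariants is realised by an intertwiner into the isotypic subspace
# (compact second group; piece P1a of the support-form proof of `rankOne_theta_lines_disjoint`)

Topic `RepresentationTheory`; namespace `Literature.RepresentationTheory.TwistedCoinv` (continuing `TwistedCoinvariants`,
`TwistedCoinvariantsCompactIsotypic`).  KERNEL ONLY: theorems, 0 definitions, 0 named facts, 0 sorry.

Setting: two commuting pairs `(ρV₁, ρW₁)` on `S₁` and `(ρV₂, ρW₂)` on `S₂` (`G` and `H` acting, `k` a field of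
characteristic `0`), characters `χ₁, χ₂ : H →* kˣ`, and an ISOMORPHISM of the coinvariant `G`-representations
`f : Coinv ρW₁ χ₁ ≃ Coinv ρW₂ χ₂` intertwining `rep χ₁ ρV₁` with `rep χ₂ ρV₂` (the tree's currency `AreIsomorphicRep` of two theta
lifts).  If `H` is COMPACT, `ρW₂` SMOOTH and `ker χ₂` OPEN — so that the `χ₂`-coinvariants ARE the `χ₂`-isotypic subspace
`E₂ = {v | ρW₂ h v = χ₂ h • v}` (`bijective_mk_domRestrict_weightSpace`, [BernsteinZelevinsky1976, §2.3]) — then `f` lifts to a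
`G`-INTERTWINER of the big spaces:

* `exists_intertwiner_of_coinv_equiv` — there is a `k`-linear `T : S₁ → S₂` with `T ∘ ρV₁ g = ρV₂ g ∘ T` for all `g`, with values
  in `E₂` (`ρW₂ h (T v) = χ₂ h • T v`), factoring the quotient map (`mk₂ (T v) = f (mk₁ v)`), hence `T ≠ 0` as soon as
  `Coinv ρW₁ χ₁ ≠ 0`: `T = (mk₂|_{E₂})⁻¹ ∘ f ∘ mk₁`.

This is the first half of piece P1 of the support-form proof of [Liu2021, Lem. D.1 (3)] at `n = 3` (cell hodgecm-mathlib row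
IV-4(c1), B-plan1 KEY 2026-08-28): an isomorphism `Θ_{s₁}(χ₁) ≅ Θ_{s₂}(χ₂)` of rank-one theta lifts (coinvariants of the
compact centre `E_v¹`) becomes an intertwiner `𝒮(F_v³) → 𝒮(F_v³)` between the two oscillator actions of `U(J)(F_v)`, landing
in the `χ₂`-eigenspace; the second half (the quasi-invariant functional on the doubled model) is
`MoeglinVignerasWaldspurger1987/RankOneThetaLinesDoubledFunctional`.

## References
* [BernsteinZelevinsky1976] I. N. Bernstein, A. V. Zelevinsky, Russian Math. Surveys 31 (1976), §2.1–2.3 (coinvariants of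
  smooth representations of compact totally disconnected groups = isotypic subspaces).
* [Liu2021] Y. Liu, Camb. J. Math. 9 (2021), App. D Lemma D.1 (3) (l. 5233) — the consumer.
-/

set_option autoImplicit false

noncomputable section

namespace Literature.RepresentationTheory.TwistedCoinv

variable {k : Type*} [Field k] [CharZero k] {G H : Type*} [Group G] [Group H]
  [TopologicalSpace H] [IsTopologicalGroup H] [CompactSpace H]
  {S₁ : Type*} [AddCommGroup S₁] [Module k S₁] {S₂ : Type*} [AddCommGroup S₂] [Module k S₂]
  (ρV₁ : Representation k G S₁) {ρW₁ : Representation k H S₁} (hc₁ : ∀ (g : G) (h : H), Commute (ρV₁ g) (ρW₁ h))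
  (ρV₂ : Representation k G S₂) {ρW₂ : Representation k H S₂} (hc₂ : ∀ (g : G) (h : H), Commute (ρV₂ g) (ρW₂ h))
  (χ₁ χ₂ : H →* kˣ)

/-- **An isomorphism of coinvariant representations lifts to an intertwiner into the isotypic subspace** (`H` compact,
`ρW₂` smooth, `ker χ₂` open).  Given `f : Coinv ρW₁ χ₁ ≃ Coinv ρW₂ χ₂` with `f ∘ rep χ₁ ρV₁ g = rep χ₂ ρV₂ g ∘ f`, the map
`T := (mk₂|_{E₂})⁻¹ ∘ f ∘ mk₁ : S₁ → S₂` (`E₂` the `χ₂`-isotypic subspace, onto which the `χ₂`-coinvariants project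
isomorphically, [BernsteinZelevinsky1976, §2.3]) is `k`-linear, intertwines `ρV₁` with `ρV₂`, takes values in `E₂`, and satisfies
`mk₂ ∘ T = f ∘ mk₁`. [cite: BernsteinZelevinsky1976, §2.3] -/
theorem exists_intertwiner_of_coinv_equiv (hρ₂ : ρW₂.IsSmooth) (hχ₂ : IsOpen (χ₂.ker : Set H))
    (f : Coinv ρW₁ χ₁ ≃ₗ[k] Coinv ρW₂ χ₂)
    (hf : ∀ (g : G) (x : Coinv ρW₁ χ₁), f (rep χ₁ ρV₁ hc₁ g x) = rep χ₂ ρV₂ hc₂ g (f x)) :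
    ∃ T : S₁ →ₗ[k] S₂, (∀ g : G, T ∘ₗ ρV₁ g = ρV₂ g ∘ₗ T) ∧
      (∀ (h : H) (v : S₁), ρW₂ h (T v) = ((χ₂ h : kˣ) : k) • T v) ∧
      ∀ v : S₁, mk ρW₂ χ₂ (T v) = f (mk ρW₁ χ₁ v) := by
  -- the dictionary `E₂ ≃ Coinv ρW₂ χ₂`
  let e₂ : weightSpace ρW₂ id (fun h => ((χ₂ h : kˣ) : k)) ≃ₗ[k] Coinv ρW₂ χ₂ :=
    LinearEquiv.ofBijective _ (bijective_mk_domRestrict_weightSpace ρW₂ χ₂ hρ₂ hχ₂)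
  have he₂ : ∀ w, e₂ w = mk ρW₂ χ₂ w := fun _ => rfl
  have he₂' : ∀ x : Coinv ρW₂ χ₂, mk ρW₂ χ₂ (e₂.symm x : S₂) = x := fun x => by
    rw [← he₂, LinearEquiv.apply_symm_apply]
  let T : S₁ →ₗ[k] S₂ :=
    (weightSpace ρW₂ id (fun h => ((χ₂ h : kˣ) : k))).subtype ∘ₗ e₂.symm.toLinearMap ∘ₗ f.toLinearMap ∘ₗ mk ρW₁ χ₁
  have hT : ∀ v : S₁, T v = (e₂.symm (f (mk ρW₁ χ₁ v)) : S₂) := fun _ => rfl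
  have hTmem : ∀ v : S₁, T v ∈ weightSpace ρW₂ id (fun h => ((χ₂ h : kˣ) : k)) := fun v => by
    rw [hT]
    exact (e₂.symm (f (mk ρW₁ χ₁ v))).2
  have hmk : ∀ v : S₁, mk ρW₂ χ₂ (T v) = f (mk ρW₁ χ₁ v) := fun v => by rw [hT, he₂']
  refine ⟨T, fun g => ?_, fun h v => ?_, hmk⟩
  · -- equivariance: both sides land in `E₂` and have the same class, and `mk₂` is injective on `E₂`
    apply LinearMap.ext
    intro v
    change T (ρV₁ g v) = ρV₂ g (T v)
    have h1 : T (ρV₁ g v) ∈ weightSpace ρW₂ id (fun h => ((χ₂ h : kˣ) : k)) := hTmem _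
    have h2 : ρV₂ g (T v) ∈ weightSpace ρW₂ id (fun h => ((χ₂ h : kˣ) : k)) :=
      map_weightSpace_le ρW₂ χ₂ (ρV₂ g) (hc₂ g) ⟨T v, hTmem v, rfl⟩
    refine eq_of_mk_eq ρW₂ χ₂ hρ₂ hχ₂ h1 h2 ?_
    rw [hmk, ← rep_mk χ₁ ρV₁ hc₁, hf, ← hmk, rep_mk]
  · have := (mem_weightSpace.1 (hTmem v)) h
    exact this

/-- **… and the intertwiner is non-zero** when the coinvariants are: with `Coinv ρW₁ χ₁ ≠ 0`, the `T` of
`exists_intertwiner_of_coinv_equiv` has a non-zero value (`mk₂ ∘ T = f ∘ mk₁` is onto a non-zero space).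
[cite: BernsteinZelevinsky1976, §2.3] -/
theorem exists_intertwiner_ne_zero_of_coinv_equiv [Nontrivial (Coinv ρW₁ χ₁)] (hρ₂ : ρW₂.IsSmooth)
    (hχ₂ : IsOpen (χ₂.ker : Set H)) (f : Coinv ρW₁ χ₁ ≃ₗ[k] Coinv ρW₂ χ₂)
    (hf : ∀ (g : G) (x : Coinv ρW₁ χ₁), f (rep χ₁ ρV₁ hc₁ g x) = rep χ₂ ρV₂ hc₂ g (f x)) :
    ∃ T : S₁ →ₗ[k] S₂, T ≠ 0 ∧ (∀ g : G, T ∘ₗ ρV₁ g = ρV₂ g ∘ₗ T) ∧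
      (∀ (h : H) (v : S₁), ρW₂ h (T v) = ((χ₂ h : kˣ) : k) • T v) ∧
      ∀ v : S₁, mk ρW₂ χ₂ (T v) = f (mk ρW₁ χ₁ v) := by
  obtain ⟨T, hTg, hTh, hmk⟩ := exists_intertwiner_of_coinv_equiv ρV₁ hc₁ ρV₂ hc₂ χ₁ χ₂ hρ₂ hχ₂ f hf
  refine ⟨T, fun hT0 => ?_, hTg, hTh, hmk⟩
  obtain ⟨x, hx⟩ := exists_ne (0 : Coinv ρW₁ χ₁)
  obtain ⟨v, rfl⟩ := mk_surjective ρW₁ χ₁ x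
  apply hx
  apply f.injective
  rw [← hmk, hT0, LinearMap.zero_apply, map_zero, map_zero]

end Literature.RepresentationTheory.TwistedCoinv

end
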